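import Summits.CriticalPhenomena.PercolationContinuityZ3.Theorems.Transplant.FKConnectivityAllQEdgeLocal
import Literature.Probability.LatticeModels.RandomClusterRayleighSeriesParallel
import HarnessLib

/-!
# Connectivity correlation inequalities for `φ_{w,q}`, every `q > 0` — file 8: the hub inequality and pairwise positive correlation
# of connection events on SERIES–PARALLEL supports for every `q ∈ (0,1)`, from Wagner's Potts–Rayleigh theorem (named fact)

Support file (`--supports stmt-CriticalPhenomena-4575`), FK sub-lane `prim-bschramm-fk-2` (gen 6) of the post-continuity
programme; builds on p205010 (kernel theorem, internal audit signed; external expert review pending).  No definitions, no sorries;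
standard axioms; CONDITIONAL on the named fact `Wagner2008_rc_edgeNegCorr_of_noK4Minor` (Wagner, Ann. Comb. 2008, graph case:
for `0 < q ≤ 1` the random-cluster measure is edge-negatively associated on every weighted graph without a `K₄` minor — statement
only in `Literature/Probability/LatticeModels/RandomClusterRayleighSeriesParallel.lean`).

* `FK.hasK4Minor_mono` — a `K₄` minor of a subgraph is a `K₄` minor of the graph (branch sets).
* **`FK.pairConnPosUnder_of_noK4Minor`**: for `0 < q < 1`, every weight vector `w` on `Fin n` and vertices `x, y, u, v` such that the
  graph `supp(w) ∪ {xy, uv}` has no `K₄` minor, `φ_{w,q}(x ↔ y)·φ_{w,q}(u ↔ v) ≤ φ_{w,q}(x ↔ y, u ↔ v)` — via the support-restricted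
  reduction `FK.pairConnPosUnder_of_edgeNegCorr_on` (negative edge correlation on the support ⇒ positive connection correlation).
* **`FK.hubUnder_of_noK4Minor`**: in particular Ayyer–Linusson–Ravichandran's hub inequality (13), `φ(o↔a)φ(b↔a) ≤ φ(o↔a↔b)`, holds at
  every `q ∈ (0,1)` on every series–parallel weighted graph for which `G + oa + ab` is still series–parallel (e.g. along every path of
  edges `o – a – b`).  ALR prove (13) for outerplanar graphs (their Thm. 5.3); this is a different partial result on their open
  problem, conditional only on Wagner's published theorem.
[cite: Wagner2006, Ex. 5.1, Thm. 5.8(d), §5.2, §5.3] [cite: AyyerLinussonRavichandran2025, §7 eq. (13), Thm. 5.3 (p. 22)]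
[cite: Grimmett2006, §3.9 eq. (3.94) (pp. 63–64)]
-/

noncomputable section

namespace Summit.CriticalPhenomena.PercolationContinuityZ3.Theorems

namespace FK

open MeasureTheory Set Literature.Probability.LatticeModels Literature.Probability.Percolation
open scoped Classical

/-- A `K₄` minor of a subgraph is a `K₄` minor of the graph (same branch sets). [folklore] -/
theorem hasK4Minor_mono {V : Type*} {G G' : SimpleGraph V} (h : G ≤ G') (hG : HasK4Minor G) : HasK4Minor G' := by
  obtain ⟨B, hne, hconn, hdisj, hadj⟩ := hG
  refine ⟨B, hne, fun i => (hconn i).mono fun a b hab => ?_, hdisj, fun i j hij => ?_⟩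
  · exact h hab
  · obtain ⟨a, ha, b, hb, hab⟩ := hadj i j hij
    exact ⟨a, ha, b, hb, h hab⟩

/-- **Pairwise positive correlation of connection events on `K₄`-minor-free supports, every `q ∈ (0,1)`** (conditional on Wagner's
theorem): if `supp(w) ∪ {xy, uv}` has no `K₄` minor then `φ_{w,q}(x ↔ y)·φ_{w,q}(u ↔ v) ≤ φ_{w,q}(x ↔ y, u ↔ v)`.
[cite: Wagner2006, Thm. 5.8(d), §5.3] [cite: AyyerLinussonRavichandran2025, §7 eq. (13)–(15) (p. 22)] -/
theorem pairConnPosUnder_of_noK4Minor (hW : Wagner2008_rc_edgeNegCorr_of_noK4Minor) {q : ℝ} (hq0 : 0 < q) (hq1 : q < 1)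
    {n : ℕ} (w : Sym2 (Fin n) → unitInterval) (x y u v : Fin n)
    (hG : ¬ HasK4Minor (SimpleGraph.fromEdgeSet
      ({e : Sym2 (Fin n) | ((w e : unitInterval) : ℝ) ≠ 0} ∪ {s(x, y), s(u, v)}))) :
    PairConnPosUnder (rcMeasureW w q ∅) x y u v := by
  refine pairConnPosUnder_of_edgeNegCorr_on hq0 hq1
    ({e : Sym2 (Fin n) | ((w e : unitInterval) : ℝ) ≠ 0} ∪ {s(x, y), s(u, v)}) ?_ x y u v
    (Or.inr (Set.mem_insert _ _)) (Or.inr (Set.mem_insert_of_mem _ (Set.mem_singleton _))) w (fun e he => Or.inl he)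
  intro u' hu' e f hdiag hfe
  refine hW n u' q hq0 hq1.le (fun hK => hG (hasK4Minor_mono (SimpleGraph.fromEdgeSet_mono ?_) hK)) e f hdiag hfe
  intro e he
  exact hu' e he

/-- **The hub inequality on series–parallel supports, every `q ∈ (0,1)`** (Ayyer–Linusson–Ravichandran 2025 (13); conditional on
Wagner's theorem): if `supp(w) ∪ {oa, ba}` has no `K₄` minor then `φ_{w,q}(o ↔ a)·φ_{w,q}(b ↔ a) ≤ φ_{w,q}(o ↔ a ↔ b)`.
[cite: AyyerLinussonRavichandran2025, §7 eq. (13), Conj. 7.1 (p. 22)] [cite: Wagner2006, Thm. 5.8(d), §5.3] -/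
theorem hubUnder_of_noK4Minor (hW : Wagner2008_rc_edgeNegCorr_of_noK4Minor) {q : ℝ} (hq0 : 0 < q) (hq1 : q < 1)
    {n : ℕ} (w : Sym2 (Fin n) → unitInterval) (o a b : Fin n)
    (hG : ¬ HasK4Minor (SimpleGraph.fromEdgeSet
      ({e : Sym2 (Fin n) | ((w e : unitInterval) : ℝ) ≠ 0} ∪ {s(o, a), s(b, a)}))) :
    HubUnder (rcMeasureW w q ∅) o a b :=
  hubUnder_of_pairConnPosUnder _ o a b (pairConnPosUnder_of_noK4Minor hW hq0 hq1 w o a b a hG)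

end FK

end Summit.CriticalPhenomena.PercolationContinuityZ3.Theorems

end
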